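import Summits.AtomisticToContinuum.HydrodynamicLimit.Theorems.AntiMazurCoboundariesCorrectorPressureDecayKiferFreeBoxMeanCount
import Summits.AtomisticToContinuum.HydrodynamicLimit.Theorems.AntiMazurCoboundariesCorrectorPressureDecayKiferCollarTrick
import Summits.AtomisticToContinuum.HydrodynamicLimit.Theorems.AntiMazurCoboundariesCorrectorPressureDecayKiferChebyshevPush
import Literature.MathematicalPhysics.KineticTheory.CollisionTubePullbackPacking

/-!
# Exact particle counts of a free hard-sphere box are not exponentially rare (line `FirstLemma`, crux stmt-AtomisticToContinuum-14135)

Registered stub `c9_free_box_count_ge_exp_neg_of_var` (lead seat c9; piece (B4') of the thermodynamic step of the Gibbs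
route of the tangent entropy bound, with the variance bound (B2') as an explicit hypothesis), namespace
`Summit.AtomisticToContinuum.HydrodynamicLimit.Theorems.KiferCompactification`.

Let `γ = gibbsSpecMeasure 1 z β u (c9Box a ℓ) ∅` be the FREE grand-canonical law of the unit-diameter hard-sphere gas in
the closed box of side `ℓ` at position `a` (activity `0 < z ≤ 1/64`, Maxwellian marks at `β > 0`), `N` the particle
number, `p_j = γ{N = j}`, and `ρ = density G` the density of a translation-invariant Gibbs state `G` at the same
activity. If `Var_γ N ≤ C ℓ³` for all boxes of side `ℓ ≥ 1` (hypothesis `hvar`), then for every `η > 0` there is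
`ℓ₀` such that `p_k ≥ e^{-η ℓ³}` whenever `ℓ ≥ ℓ₀` and `|k - ρ ℓ³| ≤ 2ℓ² + 10`.

Proof (Chebyshev–pigeonhole–push). The law `p` of `N` is carried by `{0, …, K}` (packing: `γ` is carried by
hard-core configurations above the box, `gibbsSpecMeasure_empty_compl_isHardCore_eq_zero`,
`gibbsSpecMeasure_empty_compl_count_eq_zero`, `card_le_of_separated`), so Bochner integrals of functions of `N` are
finite sums (`integral_comp_count_eq_sum`). The mean is `m̄ = ρ ℓ³ + O(ℓ²)` (`c9_free_box_mean_count_sub_le`), the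
variance is `≤ C₂ ℓ³` (`hvar`), the density satisfies `7z/8 ≤ ρ ≤ z` (GNZ sandwich `activity_density_sandwich`), and on
the window `zℓ³/8 ≤ j + 1 ≤ 2zℓ³` the insertion ratios `p_{j+1}/p_j` lie in `[1/8, 8]` (`free_box_ratio_bounds`, from
`c9_free_count_succ_ratio_bounds`: `z(ℓ³ - 4πj/3)/(j+1) ≥ 5/12` and `zℓ³/(j+1) ≤ 8` there). The abstract lemma
`c9_pointMass_ge_of_chebyshev_push'` on the window `[⌊min(k, m̄ - 2√V)⌋₊, ⌈max(k, m̄ + 2√V)⌉₊]`, of length `O(ℓ²)`,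
gives `p_k ≥ 3/(4(4√V + 2)) · 8^{-O(ℓ²)} = e^{-O(ℓ²)}` (`pointMass_ge_exp_of_moment_bounds`), which beats `e^{-ηℓ³}` for
`ℓ ≥ ℓ₀(η)`.

References: D. Ruelle, *Statistical Mechanics: Rigorous Results* (1969), §3.4; R. L. Dobrushin, B. Tirozzi, Comm. Math.
Phys. 54 (1977) 173–192 (local central limit theorem and equivalence of ensembles); D. Dereudre, LNM 2237 (2019), §2.5.
No definitions, no named facts.
-/

noncomputable section

open MeasureTheory ProbabilityTheory Set Filter Topology
open scoped ENNReal NNReal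

namespace Summit.AtomisticToContinuum.HydrodynamicLimit.Theorems.KiferCompactification

open Literature.MathematicalPhysics.KineticTheory (V3 card_le_of_separated)
open Literature.MathematicalPhysics.KineticTheory.HardSphereDLR (gibbsSpecMeasure count_eq_zero_iff'
  measurable_toENNReal_count activity_density_sandwich density_le_activity)
open Literature.MathematicalPhysics.KineticTheory.PointProcess (density)
open Literature.Analysis.FluidPDE (IsHardCore IsHardSphereGibbs IsTranslationInvariant)
open Literature.Analysis.FunctionSpaces (PointConfig)

/-! ## Packing: the particle number of the free box law is bounded -/

/-- **Packing.** A unit-hard-core configuration with no particle above `Λᶜ`, where `Λ ⊆ B̄(0, R₀)`, has finitely many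
particles, at most `⌊(2R₀ + 1)³⌋₊` of them (`card_le_of_separated`: centres of norm `≤ R₀`, pairwise `≥ 1` apart). -/
theorem exists_count_univ_eq_of_isHardCore {Λ : Set V3} {R₀ : ℝ} (hR₀ : 0 ≤ R₀) (hΛ : Λ ⊆ Metric.closedBall 0 R₀)
    {X : PointConfig (V3 × V3)} (hX : IsHardCore 1 X) (hXΛ : X.count (Prod.fst ⁻¹' Λᶜ) = 0) :
    ∃ j : ℕ, j ≤ ⌊(2 * R₀ + 1) ^ 3⌋₊ ∧ X.count univ = (j : ℕ∞) := by
  have hpos : ∀ p ∈ X, p.1 ∈ Λ := fun p hp => by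
    by_contra h
    exact (count_eq_zero_iff'.1 hXΛ) p hp h
  have hfin : X.carrier.Finite := by
    have h := Literature.Analysis.FluidPDE.IsHardCore.posLocallyFinite one_pos hX (Metric.closedBall (0 : V3) R₀)
      (isCompact_closedBall 0 R₀)
    exact h.subset fun p hp => ⟨hp, hΛ (hpos p hp)⟩
  refine ⟨hfin.toFinset.card, Nat.le_floor ?_, ?_⟩
  · have hR : ∀ p ∈ hfin.toFinset, ‖p.1‖ ≤ R₀ := fun p hp =>
      mem_closedBall_zero_iff.1 (hΛ (hpos p (hfin.mem_toFinset.1 hp)))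
    have hsep : ∀ p ∈ hfin.toFinset, ∀ p' ∈ hfin.toFinset, p ≠ p' → (1 : ℝ) ≤ ‖p.1 - p'.1‖ :=
      fun p hp p' hp' hne => hX p (hfin.mem_toFinset.1 hp) p' (hfin.mem_toFinset.1 hp') hne
    have h := card_le_of_separated hfin.toFinset Prod.fst one_pos hR₀ hR hsep
    rwa [div_one] at h
  · show (X.carrier ∩ univ).encard = _
    rw [inter_univ, hfin.encard_eq_coe_toFinset_card]

/-- **The particle number of the free law of a bounded window is a.s. bounded**: `γ_Λ(· | ∅)` is carried by unit-hard-core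
configurations (`gibbsSpecMeasure_empty_compl_isHardCore_eq_zero`) above `Λ` (`gibbsSpecMeasure_empty_compl_count_eq_zero`),
and packing applies. -/
theorem free_ae_exists_count_univ_eq {z β : ℝ} (hz : 0 ≤ z) (hβ : 0 < β) (u : V3) {Λ : Set V3}
    (hΛ : MeasurableSet Λ) (hΛb : Bornology.IsBounded Λ) :
    ∃ K : ℕ, ∀ᵐ X ∂(gibbsSpecMeasure 1 z β u Λ ∅), ∃ j : ℕ, j ≤ K ∧ X.count univ = (j : ℕ∞) := by
  obtain ⟨R₀, hR₀, hΛR⟩ := hΛb.subset_closedBall_lt 0 (0 : V3)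
  refine ⟨⌊(2 * R₀ + 1) ^ 3⌋₊, ?_⟩
  have h1 : ∀ᵐ X ∂(gibbsSpecMeasure 1 z β u Λ ∅), IsHardCore 1 X := by
    rw [ae_iff, ← compl_setOf]
    exact gibbsSpecMeasure_empty_compl_isHardCore_eq_zero hz hβ u hΛ hΛb
  have h2 : ∀ᵐ X ∂(gibbsSpecMeasure 1 z β u Λ ∅), X.count (Prod.fst ⁻¹' Λᶜ) = 0 := by
    rw [ae_iff, ← compl_setOf]
    exact gibbsSpecMeasure_empty_compl_count_eq_zero 1 z β u hΛ
  filter_upwards [h1, h2] with X hX hXΛ using exists_count_univ_eq_of_isHardCore hR₀.le hΛR hX hXΛ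

/-- **Integrals of functions of a bounded particle number are finite sums**: if `N ≤ K` a.s., then
`∫ φ(N) dμ = ∑_{j ≤ K} φ(j) μ{N = j}` for every `φ : ℝ → ℝ` (a.s. `φ ∘ N = ∑_j φ(j) 1_{N = j}`). -/
theorem integral_comp_count_eq_sum {μ : Measure (PointConfig (V3 × V3))} [IsFiniteMeasure μ] {K : ℕ}
    (hK : ∀ᵐ X ∂μ, ∃ j : ℕ, j ≤ K ∧ X.count univ = (j : ℕ∞)) (φ : ℝ → ℝ) :
    ∫ X, φ (((X.count univ : ℕ∞) : ℝ≥0∞).toReal) ∂μ =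
      ∑ j ∈ Finset.range (K + 1), φ (j : ℝ) * μ.real {X : PointConfig (V3 × V3) | X.count univ = (j : ℕ∞)} := by
  have hae : (fun X : PointConfig (V3 × V3) => φ (((X.count univ : ℕ∞) : ℝ≥0∞).toReal)) =ᵐ[μ] fun X =>
      ∑ j ∈ Finset.range (K + 1),
        {Y : PointConfig (V3 × V3) | Y.count univ = (j : ℕ∞)}.indicator (fun _ => φ (j : ℝ)) X := by
    filter_upwards [hK] with X hX
    obtain ⟨i, hi, hXi⟩ := hX
    have hmem : X ∈ {Y : PointConfig (V3 × V3) | Y.count univ = (i : ℕ∞)} := hXi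
    rw [Finset.sum_eq_single_of_mem i (Finset.mem_range.2 (by omega))]
    · rw [indicator_of_mem hmem, hXi]
      simp only [ENat.toENNReal_coe, ENNReal.toReal_natCast]
    · intro j _ hji
      refine indicator_of_notMem (fun h => hji ?_) _
      have h' : X.count univ = (j : ℕ∞) := h
      rw [hXi] at h'
      exact_mod_cast h'.symm
  rw [integral_congr_ae hae, integral_finsetSum (Finset.range (K + 1)) fun (j : ℕ) _ =>
    (integrable_const (φ (j : ℝ))).indicator (measurableSet_countUniv_eq j)]
  refine Finset.sum_congr rfl fun j _ => ?_
  rw [integral_indicator_const _ (measurableSet_countUniv_eq j), smul_eq_mul, mul_comm]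

/-! ## The insertion ratios on the relevant window -/

/-- **Two-sided insertion-ratio bounds for the free box**, from `c9_free_count_succ_ratio_bounds`: with `T = zℓ³`
(`0 < z ≤ 1/64`), for `T/8 ≤ j + 1 ≤ 2T` one has `p_{j+1} ≥ p_j / 8` (the free volume after `j ≤ 2T` insertions is
`≥ ℓ³ - (4π/3) j ≥ 5ℓ³/6`, so the lower ratio is `≥ (5/6) T/(j+1) ≥ 5/12`) and `p_j ≥ p_{j+1} / 8` (the upper ratio is
`T/(j+1) ≤ 8`). -/
theorem free_box_ratio_bounds {z β : ℝ} {u : V3} (hz : 0 < z) (hz1 : z ≤ 1 / 64) (hβ : 0 < β) (a : V3) {ℓ : ℝ}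
    (hℓ : 0 ≤ ℓ) {j : ℕ} (hjdown : z * ℓ ^ 3 / 8 ≤ (j : ℝ) + 1) (hjup : (j : ℝ) + 1 ≤ 2 * (z * ℓ ^ 3)) :
    1 / 8 * (gibbsSpecMeasure 1 z β u (c9Box a ℓ) ∅).real {X : PointConfig (V3 × V3) | X.count univ = (j : ℕ∞)} ≤
        (gibbsSpecMeasure 1 z β u (c9Box a ℓ) ∅).real
          {X : PointConfig (V3 × V3) | X.count univ = ((j + 1 : ℕ) : ℕ∞)} ∧
      1 / 8 * (gibbsSpecMeasure 1 z β u (c9Box a ℓ) ∅).real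
          {X : PointConfig (V3 × V3) | X.count univ = ((j + 1 : ℕ) : ℕ∞)} ≤
        (gibbsSpecMeasure 1 z β u (c9Box a ℓ) ∅).real {X : PointConfig (V3 × V3) | X.count univ = (j : ℕ∞)} := by
  have hΛ : MeasurableSet (c9Box a ℓ) := freeBox_measurableSet a ℓ
  have hΛb : Bornology.IsBounded (c9Box a ℓ) := freeBox_isBounded a ℓ
  haveI : IsProbabilityMeasure (gibbsSpecMeasure 1 z β u (c9Box a ℓ) ∅) :=
    isProbabilityMeasure_gibbsSpecMeasure_empty hz.le hβ u hΛ hΛb.measure_lt_top.ne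
  have hvol : (volume (c9Box a ℓ)).toReal = ℓ ^ 3 := by
    rw [freeBox_volume, ENNReal.toReal_pow, ENNReal.toReal_ofReal hℓ]
  obtain ⟨hB3l, hB3u⟩ := c9_free_count_succ_ratio_bounds (u := u) hz hβ hΛ hΛb j
  rw [hvol] at hB3l hB3u
  have hℓ3 : 0 ≤ ℓ ^ 3 := pow_nonneg hℓ 3
  have hj0 : (0 : ℝ) ≤ j := Nat.cast_nonneg j
  have hj1pos : (0 : ℝ) < (j : ℝ) + 1 := by positivity
  have hzℓ64 : z * ℓ ^ 3 ≤ 1 / 64 * ℓ ^ 3 := mul_le_mul_of_nonneg_right hz1 hℓ3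
  -- the free volume after `j` insertions is at least `5ℓ³/6`
  have hπj : 4 * Real.pi / 3 * (j : ℝ) ≤ ℓ ^ 3 / 6 := by
    have h1 : 4 * Real.pi / 3 * (j : ℝ) ≤ 16 / 3 * (j : ℝ) := by nlinarith only [Real.pi_le_four, hj0]
    linarith only [h1, hjup, hzℓ64, hj0]
  have hcj : 1 / 8 ≤ z * (ℓ ^ 3 - 4 * Real.pi / 3 * j) / ((j : ℝ) + 1) := by
    rw [le_div_iff₀ hj1pos]
    have h : z * (5 / 6 * ℓ ^ 3) ≤ z * (ℓ ^ 3 - 4 * Real.pi / 3 * j) :=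
      mul_le_mul_of_nonneg_left (by linarith only [hπj]) hz.le
    linarith only [h, hjup, hj0]
  have hcj0 : 0 ≤ z * (ℓ ^ 3 - 4 * Real.pi / 3 * j) / ((j : ℝ) + 1) := le_trans (by norm_num) hcj
  have hdj : z * ℓ ^ 3 / ((j : ℝ) + 1) ≤ 8 := by
    rw [div_le_iff₀ hj1pos]
    linarith only [hjdown]
  have h1 := ENNReal.toReal_mono (measure_ne_top _ _) hB3l
  rw [ENNReal.toReal_mul, ENNReal.toReal_ofReal hcj0] at h1
  have h2 := ENNReal.toReal_mono (ENNReal.mul_ne_top ENNReal.ofReal_ne_top (measure_ne_top _ _)) hB3u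
  rw [ENNReal.toReal_mul, ENNReal.toReal_ofReal (by positivity)] at h2
  simp only [measureReal_def]
  refine ⟨le_trans (mul_le_mul_of_nonneg_right hcj ENNReal.toReal_nonneg) h1, ?_⟩
  calc 1 / 8 * (gibbsSpecMeasure 1 z β u (c9Box a ℓ) ∅ {X | X.count univ = ((j + 1 : ℕ) : ℕ∞)}).toReal
      ≤ 1 / 8 * (z * ℓ ^ 3 / ((j : ℝ) + 1) *
          (gibbsSpecMeasure 1 z β u (c9Box a ℓ) ∅ {X | X.count univ = (j : ℕ∞)}).toReal) :=
        mul_le_mul_of_nonneg_left h2 (by norm_num)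
    _ ≤ 1 / 8 * (8 * (gibbsSpecMeasure 1 z β u (c9Box a ℓ) ∅ {X | X.count univ = (j : ℕ∞)}).toReal) :=
        mul_le_mul_of_nonneg_left (mul_le_mul_of_nonneg_right hdj ENNReal.toReal_nonneg) (by norm_num)
    _ = _ := by ring

/-! ## The Chebyshev–pigeonhole–push estimate in the form used here -/

/-- **Point masses near the centre are `≥ e^{-18E}`.** Pure bookkeeping around `c9_pointMass_ge_of_chebyshev_push'`:
a law `p` on the finite carrier `s ⊆ ℕ` with second moment `≤ V` about `m`, a count `k` with
`|k - m| + 2√V ≤ E`, `7T/8 - E ≤ k ≤ T + E`, `1 ≤ E`, `5E ≤ T`, and two-sided ratio bounds `1/8` on the window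
`T/8 ≤ j + 1 ≤ 2T`, has `p k ≥ e^{-18E}`: the push window `[⌊min(k, m - 2√V)⌋₊, ⌈max(k, m + 2√V)⌉₊]` lies in the
ratio window and has length `≤ 4E`, so `p k ≥ 3/(4(4√V + 2)) · 8^{-4E} ≥ e^{-6E} e^{-12E}`. -/
theorem pointMass_ge_exp_of_moment_bounds (s : Finset ℕ) (p : ℕ → ℝ) (hp0 : ∀ j, 0 ≤ p j)
    (hp1 : ∑ j ∈ s, p j = 1) (m : ℝ) {V E T : ℝ} (hV0 : 0 ≤ V) (hV : ∑ j ∈ s, ((j : ℝ) - m) ^ 2 * p j ≤ V)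
    (hE1 : 1 ≤ E) (hT : 5 * E ≤ T) (k : ℕ) (hkm : |(k : ℝ) - m| + 2 * Real.sqrt V ≤ E) (hkup : (k : ℝ) ≤ T + E)
    (hklow : 7 / 8 * T - E ≤ k)
    (hratio : ∀ j : ℕ, T / 8 ≤ (j : ℝ) + 1 → (j : ℝ) + 1 ≤ 2 * T →
      1 / 8 * p j ≤ p (j + 1) ∧ 1 / 8 * p (j + 1) ≤ p j) :
    Real.exp (-(18 * E)) ≤ p k := by
  obtain ⟨hkm1, hkm2⟩ := abs_le.1 (le_refl |(k : ℝ) - m|)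
  have hsV : 0 ≤ 2 * Real.sqrt V := by positivity
  -- the push window
  set M : ℝ := max (k : ℝ) (m + 2 * Real.sqrt V) with hM
  set m₀ : ℝ := min (k : ℝ) (m - 2 * Real.sqrt V) with hm₀
  have hMk : M ≤ k + E := max_le (by linarith) (by linarith)
  have hm₀k : (k : ℝ) - E ≤ m₀ := le_min (by linarith) (by linarith)
  have hm₀1 : T / 8 + 1 ≤ m₀ := by linarith
  have hM1 : M + 1 ≤ 2 * T := by linarith
  have hm₀pos : 0 ≤ m₀ := by linarith
  have hMpos : 0 ≤ M := le_trans (Nat.cast_nonneg k) (le_max_left _ _)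
  set lo : ℕ := ⌊m₀⌋₊ with hlo
  set hi : ℕ := ⌈M⌉₊ with hhi
  have hlo_le : (lo : ℝ) ≤ m₀ := Nat.floor_le hm₀pos
  have hlo_gt : m₀ < lo + 1 := Nat.lt_floor_add_one m₀
  have hhi_ge : M ≤ hi := Nat.le_ceil M
  have hhi_lt : (hi : ℝ) < M + 1 := Nat.ceil_lt_add_one hMpos
  have hlok : lo ≤ k := by
    have h : lo ≤ ⌊(k : ℝ)⌋₊ := Nat.floor_le_floor (min_le_left _ _)
    rwa [Nat.floor_natCast] at h
  have hkhi : k ≤ hi := by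
    have h : ⌈(k : ℝ)⌉₊ ≤ hi := Nat.ceil_le_ceil (le_max_left _ _)
    rwa [Nat.ceil_natCast] at h
  have hlo' : (lo : ℝ) ≤ m - 2 * Real.sqrt V := hlo_le.trans (min_le_right _ _)
  have hhi' : m + 2 * Real.sqrt V ≤ hi := (le_max_right _ _).trans hhi_ge
  -- the ratio bounds hold on the push window
  have hratio' : ∀ j, lo ≤ j → j < hi → 1 / 8 * p j ≤ p (j + 1) ∧ 1 / 8 * p (j + 1) ≤ p j := by
    intro j hj1 hj2
    have hjlo : (lo : ℝ) ≤ j := by exact_mod_cast hj1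
    have hjhi : (j : ℝ) + 1 ≤ hi := by exact_mod_cast Nat.succ_le_of_lt hj2
    exact hratio j (by linarith) (by linarith)
  have hpush := c9_pointMass_ge_of_chebyshev_push' s p hp0 hp1 (r := 1 / 8) (by norm_num) (by norm_num) hratio' m hV0
    hV hlo' hhi' k hlok hkhi
  -- the cost is `e^{-O(E)}`
  have hD : ((hi - lo : ℕ) : ℝ) ≤ 4 * E := by
    rw [Nat.cast_sub (hlok.trans hkhi)]
    linarith
  have hexp1 : Real.exp (-(6 * E)) ≤ 3 / (4 * (4 * Real.sqrt V + 2)) := by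
    rw [Real.exp_neg, le_div_iff₀ (by positivity), inv_mul_le_iff₀ (Real.exp_pos _)]
    have h4 : 4 * (4 * Real.sqrt V + 2) ≤ 16 * E := by linarith [abs_nonneg ((k : ℝ) - m)]
    nlinarith [Real.add_one_le_exp (6 * E)]
  have h8 : Real.exp (-3) ≤ 1 / 8 := by
    rw [Real.exp_neg, one_div]
    refine inv_anti₀ (by norm_num) ?_
    have h1 : (2 : ℝ) ≤ Real.exp 1 := by linarith [Real.add_one_le_exp (1 : ℝ)]
    calc (8 : ℝ) = 2 ^ 3 := by norm_num
      _ ≤ Real.exp 1 ^ 3 := pow_le_pow_left₀ (by norm_num) h1 3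
      _ = Real.exp 3 := by rw [← Real.exp_nat_mul]; norm_num
  have hexp2 : Real.exp (-(12 * E)) ≤ (1 / 8 : ℝ) ^ (hi - lo) := by
    calc Real.exp (-(12 * E)) ≤ Real.exp (((hi - lo : ℕ) : ℝ) * (-3)) := Real.exp_le_exp.2 (by linarith)
      _ = Real.exp (-3) ^ (hi - lo) := Real.exp_nat_mul _ _
      _ ≤ (1 / 8 : ℝ) ^ (hi - lo) := pow_le_pow_left₀ (Real.exp_nonneg _) h8 _
  calc Real.exp (-(18 * E)) = Real.exp (-(6 * E)) * Real.exp (-(12 * E)) := by rw [← Real.exp_add]; congr 1; ring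
    _ ≤ 3 / (4 * (4 * Real.sqrt V + 2)) * (1 / 8 : ℝ) ^ (hi - lo) :=
        mul_le_mul hexp1 hexp2 (Real.exp_nonneg _) (by positivity)
    _ ≤ p k := hpush

/-! ## The registered stub -/

/-- Registered stub `c9_free_box_count_ge_exp_neg_of_var` (line `FirstLemma`, piece (B4') given the variance bound (B2')):
**exact particle counts of a free hard-sphere box near the Gibbs density are not exponentially rare.** For
`0 < z ≤ 1/64`, `β > 0`, a translation-invariant Gibbs state `G` at activity `z` with density `ρ`, and the free law
`γ = gibbsSpecMeasure 1 z β u (c9Box a ℓ) ∅` whose particle number has variance `≤ C ℓ³` (all `a`, `ℓ ≥ 1`): for every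
`η > 0` there is `ℓ₀ > 0` with `γ{N = k} ≥ e^{-η ℓ³}` for all `a`, `ℓ ≥ ℓ₀` and `|k - ρ ℓ³| ≤ 2ℓ² + 10`. Chebyshev
(mean `ρℓ³ + O(ℓ²)` by `c9_free_box_mean_count_sub_le`, variance `O(ℓ³)`), pigeonhole, and a push of length `O(ℓ²)`
along the insertion ratios `∈ [1/8, 8]` (`free_box_ratio_bounds`, GNZ sandwich `7z/8 ≤ ρ ≤ z`), assembled by
`pointMass_ge_exp_of_moment_bounds`; the cost `e^{-O(ℓ²)}` beats `e^{-ηℓ³}` for large `ℓ`. -/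
theorem c9_free_box_count_ge_exp_neg_of_var {z β : ℝ} {u : V3} (hz : 0 < z) (hz1 : z ≤ 1 / 64) (hβ : 0 < β)
    {G : Measure (PointConfig (V3 × V3))} (hG : IsHardSphereGibbs 1 z β u G) (hGT : IsTranslationInvariant G)
    (hvar : ∃ C : ℝ, ∀ (a : V3) (ℓ : ℝ), 1 ≤ ℓ →
      ∫ ω, ((((ω.count univ : ℕ∞) : ℝ≥0∞).toReal) -
          ∫ ω', (((ω'.count univ : ℕ∞) : ℝ≥0∞).toReal) ∂(gibbsSpecMeasure 1 z β u (c9Box a ℓ) ∅)) ^ 2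
        ∂(gibbsSpecMeasure 1 z β u (c9Box a ℓ) ∅) ≤ C * ℓ ^ 3)
    {η : ℝ} (hη : 0 < η) :
    ∃ ℓ₀ : ℝ, 0 < ℓ₀ ∧ ∀ (a : V3) (ℓ : ℝ), ℓ₀ ≤ ℓ → ∀ k : ℕ, |(k : ℝ) - (density G).toReal * ℓ ^ 3| ≤ 2 * ℓ ^ 2 + 10 →
      ENNReal.ofReal (Real.exp (-(η * ℓ ^ 3))) ≤ gibbsSpecMeasure 1 z β u (c9Box a ℓ) ∅ {ω | ω.count univ = k} := by
  -- ### Constants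
  obtain ⟨C₁, hC₁⟩ := c9_free_box_mean_count_sub_le hz hz1 hβ hG hGT
  obtain ⟨C₂, hC₂⟩ := hvar
  set C₁' : ℝ := max C₁ 1 with hC₁'
  set C₂' : ℝ := max C₂ 1 with hC₂'
  have hC₁'1 : 1 ≤ C₁' := le_max_right _ _
  have hC₂'1 : 1 ≤ C₂' := le_max_right _ _
  set B : ℝ := C₁' + 2 * C₂' + 13 with hB
  have hB13 : 13 ≤ B := by rw [hB]; linarith only [hC₁'1, hC₂'1]
  have hB0 : 0 < B := by linarith only [hB13]
  -- ### The density sandwich `7z/8 ≤ ρ ≤ z`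
  set ρ : ℝ := (density G).toReal with hρ
  have hρz : ρ ≤ z ∧ 7 / 8 * z ≤ ρ := by
    have hfin : density G ≠ ∞ := ne_top_of_le_ne_top ENNReal.ofReal_ne_top (density_le_activity hG hz.le hβ)
    have hρeq : density G = ENNReal.ofReal ρ := (ENNReal.ofReal_toReal hfin).symm
    obtain ⟨h1, h2⟩ := activity_density_sandwich (n := 2) hG hGT hz.le hβ (by norm_num) hρeq ENNReal.toReal_nonneg
    simp only [Fintype.card_fin] at h1
    norm_num at h1
    have h3 : z * ρ ≤ z * (1 / 64) := mul_le_mul_of_nonneg_left (h2.trans hz1) hz.le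
    exact ⟨h2, by nlinarith only [h1, h3]⟩
  obtain ⟨hρz1, hρz2⟩ := hρz
  -- ### The threshold
  refine ⟨max 1 (max (5 * B / z) (18 * B / η)), lt_max_of_lt_left one_pos, fun a ℓ hℓ k hk => ?_⟩
  have hℓ1 : 1 ≤ ℓ := le_trans (le_max_left _ _) hℓ
  have hℓ0 : 0 ≤ ℓ := zero_le_one.trans hℓ1
  have h5B : 5 * B ≤ z * ℓ := by
    have h : 5 * B / z ≤ ℓ := le_trans ((le_max_left _ _).trans (le_max_right _ _)) hℓ
    rw [div_le_iff₀ hz] at h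
    linarith only [h]
  have h18B : 18 * B ≤ η * ℓ := by
    have h : 18 * B / η ≤ ℓ := le_trans ((le_max_right _ _).trans (le_max_right _ _)) hℓ
    rw [div_le_iff₀ hη] at h
    linarith only [h]
  have hℓsq : 1 ≤ ℓ ^ 2 := one_le_pow₀ hℓ1
  have hℓ3 : 0 ≤ ℓ ^ 3 := pow_nonneg hℓ0 3
  -- the error scale `E = B ℓ²` and the count scale `T = z ℓ³`
  set E : ℝ := B * ℓ ^ 2 with hE
  have hE1 : 1 ≤ E := by rw [hE]; nlinarith only [hB13, hℓsq]
  have hE12 : 12 * ℓ ^ 2 ≤ E := by rw [hE]; nlinarith only [hB13, hℓsq]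
  have hzℓ3 : 5 * E ≤ z * ℓ ^ 3 := by
    calc 5 * E = ℓ ^ 2 * (5 * B) := by rw [hE]; ring
      _ ≤ ℓ ^ 2 * (z * ℓ) := mul_le_mul_of_nonneg_left h5B (sq_nonneg ℓ)
      _ = z * ℓ ^ 3 := by ring
  have hηℓ3 : 18 * E ≤ η * ℓ ^ 3 := by
    calc 18 * E = ℓ ^ 2 * (18 * B) := by rw [hE]; ring
      _ ≤ ℓ ^ 2 * (η * ℓ) := mul_le_mul_of_nonneg_left h18B (sq_nonneg ℓ)
      _ = η * ℓ ^ 3 := by ring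
  have hρℓ1 : ρ * ℓ ^ 3 ≤ z * ℓ ^ 3 := mul_le_mul_of_nonneg_right hρz1 hℓ3
  have hρℓ2 : 7 / 8 * z * ℓ ^ 3 ≤ ρ * ℓ ^ 3 := mul_le_mul_of_nonneg_right hρz2 hℓ3
  -- ### The free box law and the law `p` of its particle number
  have hC₁a := hC₁ a ℓ hℓ1
  have hC₂a := hC₂ a ℓ hℓ1
  have hΛ : MeasurableSet (c9Box a ℓ) := freeBox_measurableSet a ℓ
  have hΛb : Bornology.IsBounded (c9Box a ℓ) := freeBox_isBounded a ℓ
  haveI : IsProbabilityMeasure (gibbsSpecMeasure 1 z β u (c9Box a ℓ) ∅) :=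
    isProbabilityMeasure_gibbsSpecMeasure_empty hz.le hβ u hΛ hΛb.measure_lt_top.ne
  obtain ⟨K, hK⟩ := free_ae_exists_count_univ_eq hz.le hβ u hΛ hΛb
  have hratio := fun (j : ℕ) (h1 : z * ℓ ^ 3 / 8 ≤ (j : ℝ) + 1) (h2 : (j : ℝ) + 1 ≤ 2 * (z * ℓ ^ 3)) =>
    free_box_ratio_bounds (β := β) (u := u) hz hz1 hβ a hℓ0 h1 h2
  set μ : Measure (PointConfig (V3 × V3)) := gibbsSpecMeasure 1 z β u (c9Box a ℓ) ∅ with hμ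
  set p : ℕ → ℝ := fun j => μ.real {X : PointConfig (V3 × V3) | X.count univ = (j : ℕ∞)} with hp
  have hp0 : ∀ j, 0 ≤ p j := fun j => measureReal_nonneg
  have hp1 : ∑ j ∈ Finset.range (K + 1), p j = 1 := by
    calc ∑ j ∈ Finset.range (K + 1), p j
        = ∑ j ∈ Finset.range (K + 1), (fun _ : ℝ => (1 : ℝ)) (j : ℝ) *
            μ.real {X : PointConfig (V3 × V3) | X.count univ = (j : ℕ∞)} := by simp only [one_mul, hp]
      _ = ∫ X, (fun _ : ℝ => (1 : ℝ)) (((X.count univ : ℕ∞) : ℝ≥0∞).toReal) ∂μ :=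
          (integral_comp_count_eq_sum hK (fun _ : ℝ => (1 : ℝ))).symm
      _ = 1 := by simp
  -- ### Mean and variance
  set mbar : ℝ := ∫ X, (((X.count univ : ℕ∞) : ℝ≥0∞).toReal) ∂μ with hmbar
  have hmbar_eq : mbar = (∫⁻ X, ((X.count univ : ℕ∞) : ℝ≥0∞) ∂μ).toReal := by
    rw [hmbar]
    refine integral_toReal (measurable_toENNReal_count MeasurableSet.univ).aemeasurable ?_
    filter_upwards [hK] with X hX
    obtain ⟨j, -, hj⟩ := hX
    rw [hj]
    simp only [ENat.toENNReal_coe]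
    exact ENNReal.natCast_lt_top j
  have hmean : |mbar - ρ * ℓ ^ 3| ≤ C₁' * ℓ ^ 2 := by
    rw [hmbar_eq]
    exact hC₁a.trans (mul_le_mul_of_nonneg_right (le_max_left _ _) (sq_nonneg ℓ))
  set V : ℝ := C₂' * ℓ ^ 3 with hV
  have hV0 : 0 ≤ V := by rw [hV]; positivity
  have hVsum : ∑ j ∈ Finset.range (K + 1), ((j : ℝ) - mbar) ^ 2 * p j ≤ V := by
    calc ∑ j ∈ Finset.range (K + 1), ((j : ℝ) - mbar) ^ 2 * p j
        = ∫ X, ((((X.count univ : ℕ∞) : ℝ≥0∞).toReal) - mbar) ^ 2 ∂μ :=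
          (integral_comp_count_eq_sum hK fun x => (x - mbar) ^ 2).symm
      _ ≤ C₂ * ℓ ^ 3 := hC₂a
      _ ≤ C₂' * ℓ ^ 3 := mul_le_mul_of_nonneg_right (le_max_left _ _) hℓ3
  have hsqrtV : 2 * Real.sqrt V ≤ 2 * C₂' * ℓ ^ 2 := by
    have h : Real.sqrt V ≤ C₂' * ℓ ^ 2 := by
      rw [Real.sqrt_le_iff]
      refine ⟨by positivity, ?_⟩
      calc V = C₂' * ℓ ^ 3 := hV
        _ ≤ C₂' * ℓ ^ 3 * (C₂' * ℓ) := le_mul_of_one_le_right (by positivity) (by nlinarith only [hC₂'1, hℓ1])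
        _ = (C₂' * ℓ ^ 2) ^ 2 := by ring
    linarith only [h]
  -- ### The hypotheses of the bookkeeping lemma
  have hkm : |(k : ℝ) - mbar| + 2 * Real.sqrt V ≤ E := by
    have h1 : |(k : ℝ) - mbar| ≤ |(k : ℝ) - ρ * ℓ ^ 3| + |mbar - ρ * ℓ ^ 3| := by
      rw [abs_sub_comm mbar]
      exact abs_sub_le _ _ _
    have h2 : E = C₁' * ℓ ^ 2 + 2 * C₂' * ℓ ^ 2 + 13 * ℓ ^ 2 := by rw [hE, hB]; ring
    rw [h2]
    linarith only [h1, hk, hmean, hsqrtV, hℓsq]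
  have hkE : |(k : ℝ) - ρ * ℓ ^ 3| ≤ E := hk.trans (by linarith only [hE12, hℓsq])
  obtain ⟨hk1, hk2⟩ := abs_le.1 hkE
  have hkup : (k : ℝ) ≤ z * ℓ ^ 3 + E := by linarith only [hk2, hρℓ1]
  have hklow : 7 / 8 * (z * ℓ ^ 3) - E ≤ k := by linarith only [hk1, hρℓ2]
  -- ### Conclusion
  have hfinal : Real.exp (-(η * ℓ ^ 3)) ≤ p k :=
    calc Real.exp (-(η * ℓ ^ 3)) ≤ Real.exp (-(18 * E)) := Real.exp_le_exp.2 (by linarith only [hηℓ3])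
      _ ≤ p k := pointMass_ge_exp_of_moment_bounds (Finset.range (K + 1)) p hp0 hp1 mbar hV0 hVsum hE1 hzℓ3 k hkm
          hkup hklow hratio
  calc ENNReal.ofReal (Real.exp (-(η * ℓ ^ 3))) ≤ ENNReal.ofReal (p k) := ENNReal.ofReal_le_ofReal hfinal
    _ = μ {ω | ω.count univ = (k : ℕ∞)} := ENNReal.ofReal_toReal (measure_ne_top _ _)

end Summit.AtomisticToContinuum.HydrodynamicLimit.Theorems.KiferCompactification

end
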